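import Literature.AnabelianGeometry.EtaleTheta.Discharge.Sec2HuuClosureModel
import HarnessLib

/-!
# [EtTh] §2 at the §1 model, FROM A CHOSEN `X̲̲`: the `(−1)`-eigenspace `E := Π_{X̲̲} ∩ Δ_C`, the splitting
# `S := Π_{X̲̲} ∩ (D_x·Ker)`, and an inversion of order `2` normalising `Π_{X̲̲}` (proof-only; census C10)

Mochizuki, *The étale theta function and its Frobenioid-theoretic manifestations*, Publ. RIMS **45**
(2009) [EtTh], §2: Def. 2.1 p. 36, Prop. 2.2 (i)–(iii) pp. 36–38, Def. 2.3 p. 38, Def. 2.5 (i) p. 39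
(PRIMS PDF pages, printed `+226`) [cite: MochizukiEtTh2009, Prop 2.2 (ii) p.37].

Cell abc-iut, layer L2, seat abc-iut-L2-d3 (gen 6), W3-L2-02 «§2 COVER/ORBIT MODEL», census item C10.
PROOF-ONLY (0 definitions); sequel of `Sec2HuuClosureModel.lean` (p447270). For the profinite subgroup
`H := cl(ιC(inclX(C.Huu))) ⊆ P_C` of a CHOSEN `X̲̲` (abc-iut-L2-t8's `EtaleThetaData.DoubleUnderline`) over
abc-iut-L2-t10's `PiCData.coverDataAx` of the §1 model (`Π_X̲ := cl(ιC(inclX(Π^tp_X̲)))`):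

* `relIndex_eigen_ofHuu`: `[Δ_X̲ : H ∩ Δ_C] = l`;
* **`isMinusEigen_ofHuu`** — Prop. 2.2 (i) for the chosen `X̲̲`: `E := H ∩ Δ_C` IS abc-iut-L2-t2's
  `(−1)`-eigenspace datum `IsMinusEigen Π_X̲ H' ι E` for EVERY `ι ∈ Δ_C ∖ Π_X` normalising `E`;
* **`isSplitting_ofHuu`** — Prop. 2.2 (ii): `S := H ∩ (D_x·Ker)` IS a splitting of `D̄_x ↠ G_K`
  (`IsSplitting`), from abc-iut-L2-t8's `CuspAdapted`; `splitting_sup_eigen_eq_closureHuu`: `S·E = H`;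
* **`exists_inversion_ofHuu`** — Prop. 2.2 (iii) / Def. 2.3: from ONE `g ∈ Π^tp_C ∖ Π^tp_X` with
  `C.IotaStable (e.conjX g)` (Def. 2.5 (i)(b)) an inversion `ι₀ ∈ Δ_C ∖ Π_X`, `ι₀² ∈ Ker`, normalising `H`,
  with `Π_{C̲̲} := H·⟨ι₀⟩` of type `(1, l-torsΘ)±` (`IsTypeLTorsThetaPm`) and `Π_{C̲̲} ∩ Π_X = H` — the datum the
  assembly `ThetaCoversTemperedOfHuu.lean` (next file) `Classical.choose`s.

HONEST RESIDUE (named binders; no new `Prop` fact): `op : OncePuncturedData` (abc-iut-L2-t7), P-C3 `hIx`,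
P-C4 `hιell`, P-C7 `hN` (tempered normality of `inclX(Π^tp_X̲)`, L02), `hK : barKerTp l ≤ C.Huu`
("`Π^tp_{X̲̲} ⊇ Ker(Δ^tp_X ↠ Δ̄_X)`" — a clause of the DATUM `X̲̲` not recorded by `DoubleUnderline`;
GAP-LEDGER row of this seat), `C.IotaStable (e.conjX g)`, `C.CuspAdapted x` (census C10 predicates).
[EtTh] is refereed; nothing asserts that a `MuTwoSetting` exists; no side is taken on [IUTchIII] Cor. 3.12;
typed ≠ proved.
-/

noncomputable section

namespace Literature.AnabelianGeometry.EtaleTheta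

open Literature.AnabelianGeometry.SemiGraphs ThetaCovers
open _root_.Topology

namespace MuTwoSetting.CLevelData

variable {p : ℕ} [Fact p.Prime] {M : MuTwoSetting p}
variable {PC : Type} [Group PC] [TopologicalSpace PC] [IsTopologicalGroup PC] [T2Space PC]

section Binders

variable (e : M.CLevelData) (ιC : M.GtpC →ₜ* PC) (hιC : IsProfiniteCompletion ιC)
  (op : M.toThetaSetting.OncePuncturedData) {l : ℕ} (hodd : Odd l) {x : M.Pt} (hx : M.IsCusp x)
  (hIx : ((e.piCDataOf ιC hιC).Dx x ⊓ (e.piCDataOf ιC hιC).augGK.ker) ⊔ (e.piCDataOf ιC hιC).barKer l =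
    (e.piCDataOf ιC hιC).barTheta l)
  (hιell : ∀ c ∈ (e.piCDataOf ιC hιC).augGK.ker, c ∉ (e.piCDataOf ιC hιC).PiX →
    ∀ d ∈ (e.piCDataOf ιC hιC).PiX ⊓ (e.piCDataOf ιC hιC).augGK.ker,
      c * d * c⁻¹ * d ∈ (e.piCDataOf ιC hιC).barTheta l)
  (hN : ((M.GtpXu l).map M.inclX).Normal)
  {E : M.toThetaSetting.EtaleThetaData} (C : E.DoubleUnderline l) (hK : M.barKerTp l ≤ C.Huu)

/-! ### `E := H ∩ Δ_C` is the `(−1)`-eigenspace; `S := H ∩ (D_x·Ker)` is a splitting; `S·E = H` -/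

include hN in
/-- **`[Δ_X̲ : H ∩ Δ_C] = l`**: `H ↠ G_K` with `H ≤ Π_X̲`, so `H·Δ_X̲ = Π_X̲` and
`[Δ_X̲ : H ∩ Δ_X̲] = [Π_X̲ : H] = l` ("`Δ_{X̲̲}` has index `l` in `Δ_{X̲}`", Prop. 2.2 (ii); second isomorphism
theorem `relIndex_sup_eq_relIndex_of_normal`). [cite: MochizukiEtTh2009, Prop 2.2 (ii) p.37] -/
theorem relIndex_eigen_ofHuu :
    (((C.Huu.map M.inclX).map ιC.toMonoidHom).topologicalClosure ⊓ (e.piCDataOf ιC hιC).augGK.ker).relIndex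
        ((((M.GtpXu l).map M.inclX).map ιC.toMonoidHom).topologicalClosure ⊓ (e.piCDataOf ιC hιC).augGK.ker) =
      l := by
  set I := e.piCDataOf ιC hιC with hI
  set H := ((C.Huu.map M.inclX).map ιC.toMonoidHom).topologicalClosure with hH
  set Xu := (((M.GtpXu l).map M.inclX).map ιC.toMonoidHom).topologicalClosure with hXu
  haveI : Xu.Normal := closureXu_normal ιC hιC l hN
  haveI : (Xu ⊓ I.augGK.ker).Normal := Subgroup.normal_inf_normal _ _
  have hHXu : H ≤ Xu := closureHuu_le_closureXu ιC C
  have hsup : H ⊔ (Xu ⊓ I.augGK.ker) = Xu := by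
    refine le_antisymm (sup_le hHXu inf_le_left) fun g hg => ?_
    obtain ⟨h, hh, d, hd, rfl⟩ := e.exists_closureHuu_mul_delta_eq ιC hιC C hg
    exact Subgroup.mul_mem _ (Subgroup.mem_sup_left hh) (Subgroup.mem_sup_right hd)
  have hE : H ⊓ I.augGK.ker = H ⊓ (Xu ⊓ I.augGK.ker) := by
    rw [← inf_assoc, inf_eq_left.2 hHXu]
  rw [hE, Subgroup.inf_relIndex_right, ← CoverData.relIndex_sup_eq_relIndex_of_normal, hsup]
  exact e.relIndex_closureHuu_closureXu ιC hιC C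

include hN hK in
/-- **Prop. 2.2 (i) at the model, for the CHOSEN `X̲̲`: `E := H ∩ Δ_C` IS the `(−1)`-eigenspace datum
`Im(s_ι)`** of any `ι ∈ Δ_C ∖ Π_X` normalising `E` (for the covering `Π_X̲` of Def. 2.1 and any `Π_C̲ = H'`):
`Ker ≤ E` and `E ∩ Δ̄_Θ-preimage = Ker` (`Sec2HuuClosureModel`, from `hK`), `E·Δ̄_Θ-preimage = Δ_X̲` (index
count: `[Δ_X̲ : E] = l = [Δ̄_Θ-preimage : Ker]`), `Π_X̲`-stability (`Δ_X̲/Ker` abelian — abc-iut-L2-t10's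
`comm_of_mem` — and `H ↠ G_K`), `ι ≡ −1` on `E/Ker` (P-C4 `hιell` + `E ∩ Δ̄_Θ-preimage = Ker`), `ι ≡ +1` on
`Δ̄_Θ` (`inv_theta`). [cite: MochizukiEtTh2009, Prop 2.2 (i) p.37] -/
theorem isMinusEigen_ofHuu (H' : Subgroup PC) {ι : PC} (hιΔ : ι ∈ (e.piCDataOf ιC hιC).augGK.ker)
    (hιX : ι ∉ (e.piCDataOf ιC hιC).PiX)
    (hιE : ∀ e' ∈ ((C.Huu.map M.inclX).map ιC.toMonoidHom).topologicalClosure ⊓ (e.piCDataOf ιC hιC).augGK.ker,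
      ι * e' * ι⁻¹ ∈ ((C.Huu.map M.inclX).map ιC.toMonoidHom).topologicalClosure ⊓ (e.piCDataOf ιC hιC).augGK.ker) :
    ((e.piCDataOf ιC hιC).coverDataAx l op hx hodd hIx hιell
        ((e.piCDataOf ιC hιC).inv_theta_of_inv_ell l op hιell)).toCoverData.IsMinusEigen
      ((((M.GtpXu l).map M.inclX).map ιC.toMonoidHom).topologicalClosure) H' ι
      (((C.Huu.map M.inclX).map ιC.toMonoidHom).topologicalClosure ⊓ (e.piCDataOf ιC hιC).augGK.ker) := by
  haveI : NeZero l := ⟨by obtain ⟨k, hk⟩ := hodd; omega⟩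
  set I := e.piCDataOf ιC hιC with hI
  set X := I.coverDataAx l op hx hodd hIx hιell (I.inv_theta_of_inv_ell l op hιell) with hXdef
  set H := ((C.Huu.map M.inclX).map ιC.toMonoidHom).topologicalClosure with hH
  set Xu := (((M.GtpXu l).map M.inclX).map ιC.toMonoidHom).topologicalClosure with hXu
  haveI : (I.barTheta l).Normal := I.barTheta_normal l op
  haveI : (I.barKer l).Normal := I.barKer_normal l op
  have hT : X.toCoverData.IsTypeLTors Xu := e.isTypeLTors_ofSetting ιC hιC op hodd hx hIx hιell
  have hHXu : H ≤ Xu := closureHuu_le_closureXu ιC C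
  have hKH : I.barKer l ≤ H := e.barKer_le_closureHuu ιC hιC C op hK
  have hKΔ : I.barKer l ≤ I.augGK.ker := fun k hk => ((I.barKer_le_barTheta l op).trans (I.barTheta_le l op) hk).2
  have hKE : I.barKer l ≤ H ⊓ I.augGK.ker := le_inf hKH hKΔ
  have hinf : H ⊓ I.augGK.ker ⊓ I.barTheta l = I.barKer l := by
    refine le_antisymm ?_ (le_inf hKE (I.barKer_le_barTheta l op))
    exact (inf_le_inf_right _ inf_le_left).trans (e.closureHuu_inf_barTheta_le_barKer ιC hιC C op hK)
  -- `E · barTheta = Δ_X̲` by index counting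
  have hsup : (H ⊓ I.augGK.ker) ⊔ I.barTheta l = Xu ⊓ I.augGK.ker := by
    have hEΔ : H ⊓ I.augGK.ker ≤ Xu ⊓ I.augGK.ker := inf_le_inf_right _ hHXu
    have hΘΔ : I.barTheta l ≤ Xu ⊓ I.augGK.ker := le_inf hT.barTheta_le fun t ht => (I.barTheta_le l op ht).2
    have hFΔ : (H ⊓ I.augGK.ker) ⊔ I.barTheta l ≤ Xu ⊓ I.augGK.ker := sup_le hEΔ hΘΔ
    have h1 : (H ⊓ I.augGK.ker).relIndex ((H ⊓ I.augGK.ker) ⊔ I.barTheta l) = l := by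
      rw [CoverData.relIndex_sup_eq_relIndex_of_normal, ← Subgroup.inf_relIndex_right, hinf]
      exact I.relIndex_barKer l op hodd
    have h2 := Subgroup.relIndex_mul_relIndex (H ⊓ I.augGK.ker) _ _ le_sup_left hFΔ
    rw [h1, e.relIndex_eigen_ofHuu ιC hιC hN C] at h2
    have h3 : ((H ⊓ I.augGK.ker) ⊔ I.barTheta l).relIndex (Xu ⊓ I.augGK.ker) = 1 := by
      have hl : l ≠ 0 := NeZero.ne l
      have h2' : l * ((H ⊓ I.augGK.ker) ⊔ I.barTheta l).relIndex (Xu ⊓ I.augGK.ker) = l * 1 := by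
        rw [mul_one]; exact h2
      exact Nat.eq_of_mul_eq_mul_left (Nat.pos_of_ne_zero hl) h2'
    exact le_antisymm hFΔ (Subgroup.relIndex_eq_one.1 h3)
  refine
    { barKer_le := hKE
      le := inf_le_inf_right _ hHXu
      conj_mem := ?_
      inf_eq := hinf
      sup_eq := hsup
      minus := ?_
      plus := fun t ht => X.inv_theta ι hιΔ hιX t ht
      iota_conj := hιE }
  · -- `Π_X̲`-stability: `g = h·d`, `h ∈ H`, `d ∈ Δ_X̲`; `d e d⁻¹ = [d,e]·e ∈ Ker·E`
    show ∀ g ∈ Xu, ∀ e' ∈ H ⊓ I.augGK.ker, g * e' * g⁻¹ ∈ H ⊓ I.augGK.ker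
    intro g hg e' he'
    obtain ⟨h, hh, d, hd, rfl⟩ := e.exists_closureHuu_mul_delta_eq ιC hιC C hg
    have he'Xu : e' ∈ Xu := hHXu he'.1
    have he'Δ : e' ∈ X.DeltaX := ⟨e.closureXu_le_PiX ιC hιC l he'Xu, he'.2⟩
    have hdΔ : d ∈ X.DeltaX := ⟨e.closureXu_le_PiX ιC hιC l hd.1, hd.2⟩
    have hcomm : d * e' * d⁻¹ * e'⁻¹ ∈ I.barKer l := X.comm_of_mem hT hd.1 hdΔ he'Xu he'Δ
    have hde : d * e' * d⁻¹ ∈ H ⊓ I.augGK.ker := by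
      have : d * e' * d⁻¹ = (d * e' * d⁻¹ * e'⁻¹) * e' := by group
      rw [this]
      exact Subgroup.mul_mem _ (hKE hcomm) he'
    have : h * d * e' * (h * d)⁻¹ = h * (d * e' * d⁻¹) * h⁻¹ := by group
    rw [this]
    exact ⟨Subgroup.mul_mem _ (Subgroup.mul_mem _ hh hde.1) (Subgroup.inv_mem _ hh),
      (MonoidHom.normal_ker _).conj_mem _ hde.2 h⟩
  · -- `ι ≡ −1` on `E/Ker`: `ι e ι⁻¹ e ∈ E ∩ barTheta = Ker`
    show ∀ e' ∈ H ⊓ I.augGK.ker, ι * e' * ι⁻¹ * e' ∈ I.barKer l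
    intro e' he'
    have he'Δ : e' ∈ X.PiX ⊓ X.aug.ker := ⟨e.closureXu_le_PiX ιC hιC l (hHXu he'.1), he'.2⟩
    have h1 : ι * e' * ι⁻¹ * e' ∈ I.barTheta l := X.inv_ell ι hιΔ hιX e' he'Δ
    have h2 : ι * e' * ι⁻¹ * e' ∈ H ⊓ I.augGK.ker := Subgroup.mul_mem _ (hιE e' he') he'
    rw [← hinf]
    exact ⟨h2, h1⟩

variable (hA : C.CuspAdapted x)

include hK hA in
/-- **Prop. 2.2 (ii) / Def. 2.5 (i)(b) at the model: `S := H ∩ (D_x·Ker)` IS a splitting of `D̄_x ↠ G_K`**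
(`Ker ≤ S ≤ D_x·Ker`, `S ∩ Δ̄_Θ-preimage = Ker`, `S ↠ G_K` — the last from abc-iut-L2-t8's `CuspAdapted`:
`D_x ∩ Π^tp_{X̲̲} ↠ G_K`). [cite: MochizukiEtTh2009, Prop 2.2 (ii) p.37] -/
theorem isSplitting_ofHuu :
    ((e.piCDataOf ιC hιC).coverDataAx l op hx hodd hIx hιell
        ((e.piCDataOf ιC hιC).inv_theta_of_inv_ell l op hιell)).toCoverData.IsSplitting
      (((C.Huu.map M.inclX).map ιC.toMonoidHom).topologicalClosure ⊓
        ((e.piCDataOf ιC hιC).Dx x ⊔ (e.piCDataOf ιC hιC).barKer l)) := by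
  set I := e.piCDataOf ιC hιC with hI
  set H := ((C.Huu.map M.inclX).map ιC.toMonoidHom).topologicalClosure with hH
  have hKH : I.barKer l ≤ H := e.barKer_le_closureHuu ιC hιC C op hK
  refine
    { barKer_le := le_inf hKH le_sup_right
      le := inf_le_right
      inf_eq := ?_
      surj := ?_ }
  · refine le_antisymm ?_ (le_inf (le_inf hKH le_sup_right) (I.barKer_le_barTheta l op))
    exact (inf_le_inf_right _ inf_le_left).trans (e.closureHuu_inf_barTheta_le_barKer ιC hιC C op hK)
  · intro γ
    obtain ⟨s, ⟨hsH, hsD⟩, hsγ⟩ := e.exists_mem_closureHuu_inf_Dx_augGK_eq ιC hιC C hA γ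
    exact ⟨⟨s, hsH, Subgroup.mem_sup_left hsD⟩, hsγ⟩

include hA in
/-- **`S·E = H`**: `Π_{X̲̲} = S · Im(s_ι)` (Def. 2.3) for the chosen `X̲̲` (`S ↠ G_K` and `E = H ∩ Δ_C`).
[cite: MochizukiEtTh2009, Def 2.3 p.38] -/
theorem splitting_sup_eigen_eq_closureHuu :
    (((C.Huu.map M.inclX).map ιC.toMonoidHom).topologicalClosure ⊓
        ((e.piCDataOf ιC hιC).Dx x ⊔ (e.piCDataOf ιC hιC).barKer l)) ⊔
      (((C.Huu.map M.inclX).map ιC.toMonoidHom).topologicalClosure ⊓ (e.piCDataOf ιC hιC).augGK.ker) =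
      ((C.Huu.map M.inclX).map ιC.toMonoidHom).topologicalClosure := by
  set I := e.piCDataOf ιC hιC with hI
  set H := ((C.Huu.map M.inclX).map ιC.toMonoidHom).topologicalClosure with hH
  refine le_antisymm (sup_le inf_le_left inf_le_left) fun h hh => ?_
  obtain ⟨s, ⟨hsH, hsD⟩, hsγ⟩ := e.exists_mem_closureHuu_inf_Dx_augGK_eq ιC hιC C hA (I.augGK h)
  have hmem : s⁻¹ * h ∈ H ⊓ I.augGK.ker := by
    refine Subgroup.mem_inf.2 ⟨Subgroup.mul_mem _ (Subgroup.inv_mem _ hsH) hh, ?_⟩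
    rw [MonoidHom.mem_ker, map_mul, map_inv, hsγ, inv_mul_cancel]
  have : h = s * (s⁻¹ * h) := by group
  rw [this]
  exact Subgroup.mul_mem _ (Subgroup.mem_sup_left ⟨hsH, Subgroup.mem_sup_left hsD⟩) (Subgroup.mem_sup_right hmem)

/-! ### An inversion of order `2` in `Δ̄_{C̲}` normalising `H`; `Π_{C̲̲} := H·⟨ι₀⟩` -/

include hN hK hA in
/-- **Prop. 2.2 (iii) / Def. 2.3 at the model, for the CHOSEN `X̲̲`**: granted `g ∈ Π^tp_C ∖ Π^tp_X` with
`C.IotaStable (e.conjX g)` (Def. 2.5 (i)(b)), there is an inversion `ι₀ ∈ Δ_C ∖ Π_X` with `ι₀² ∈ Ker`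
("order `2` in `Δ̄_{C̲}`") normalising `H`, such that `Π_{C̲̲} := H·⟨ι₀⟩` is of abc-iut-L2-t2's type
`(1, l-torsΘ)±` and `Π_{C̲̲} ∩ Π_X = H`. Route: correct `g` into `Δ_C` by an element of `Π^tp_{X̲̲}` (`Huu ↠ G_K`),
take `Π_{C̲} := Π_X̲·⟨ιC g⟩` (type `(1, l-tors)±`), `E := H ∩ Δ_C`, `S := H ∩ (D_x·Ker)`, and abc-iut-L2-t10's
`prop22_iii_holds` / `sup_zpowers_inf_eq` / `inversion_conj_mem_sup`. [cite: MochizukiEtTh2009, Prop 2.2 (iii) p.37] -/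
theorem exists_inversion_ofHuu {g : M.GtpC} (hgX : g ∉ M.inclX.range) (hι : C.IotaStable (e.conjX g)) :
    ∃ ι₀ : PC,
      ((e.piCDataOf ιC hιC).coverDataAx l op hx hodd hIx hιell
          ((e.piCDataOf ιC hιC).inv_theta_of_inv_ell l op hιell)).toCoverData.IsTypeLTorsThetaPm
        (((C.Huu.map M.inclX).map ιC.toMonoidHom).topologicalClosure ⊔ Subgroup.zpowers ι₀) ∧
      (((C.Huu.map M.inclX).map ιC.toMonoidHom).topologicalClosure ⊔ Subgroup.zpowers ι₀) ⊓
          (e.piCDataOf ιC hιC).PiX = ((C.Huu.map M.inclX).map ιC.toMonoidHom).topologicalClosure ∧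
      ι₀ ∈ (e.piCDataOf ιC hιC).augGK.ker ∧ ι₀ ∉ (e.piCDataOf ιC hιC).PiX ∧
      ι₀ * ι₀ ∈ (e.piCDataOf ιC hιC).barKer l ∧
      ∀ h ∈ ((C.Huu.map M.inclX).map ιC.toMonoidHom).topologicalClosure,
        ι₀ * h * ι₀⁻¹ ∈ ((C.Huu.map M.inclX).map ιC.toMonoidHom).topologicalClosure := by
  haveI : NeZero l := ⟨by obtain ⟨k, hk⟩ := hodd; omega⟩
  set I := e.piCDataOf ιC hιC with hI
  set X := I.coverDataAx l op hx hodd hIx hιell (I.inv_theta_of_inv_ell l op hιell) with hXdef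
  set H := ((C.Huu.map M.inclX).map ιC.toMonoidHom).topologicalClosure with hH
  set Xu := (((M.GtpXu l).map M.inclX).map ιC.toMonoidHom).topologicalClosure with hXu
  haveI : Xu.Normal := closureXu_normal ιC hιC l hN
  haveI := I.range_normal
  have hHXu : H ≤ Xu := closureHuu_le_closureXu ιC C
  have hXuX : Xu ≤ I.PiX := e.closureXu_le_PiX ιC hιC l
  -- (1) correct `g` into `Δ_C`: `c := ιC (g · inclX y)`, `y ∈ Π^tp_{X̲̲}`, `aug y = (augC g)⁻¹`
  have hγ : (e.augC g)⁻¹ ∈ C.Huu.map M.aug.toMonoidHom := by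
    rw [C.map_aug_Huu]
    exact Subgroup.inv_mem _ (e.augC_mem_GK g)
  obtain ⟨y, hy, hyγ⟩ := hγ
  set c : PC := ιC (g * M.inclX y) with hc
  have hcΔ : c ∈ I.augGK.ker := by
    rw [I.mem_ker_augGK, hc, e.piCDataOf_aug_apply, map_mul, e.augC_inclX]
    change e.augC g * M.aug.toMonoidHom y = 1
    rw [hyγ, mul_inv_cancel]
  have hcX : c ∉ I.PiX := by
    intro h
    have h' := (mem_range_hatInclX_iff ιC hιC I.incl (e.piCDataOf_incl_toHat ιC hιC) _).1 h
    have : g ∈ M.inclX.range := by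
      have h'' := Subgroup.mul_mem _ h' (Subgroup.inv_mem _ (⟨y, rfl⟩ : M.inclX y ∈ M.inclX.range))
      rwa [mul_inv_cancel_right] at h''
    exact hgX this
  -- `X̲̲` is stable under `conjX (g · inclX y)`: `conjX (g·inclX y) x = conjX g (y x y⁻¹)`
  have hι' : C.IotaStable (e.conjX (g * M.inclX y)) := by
    refine ThetaSetting.EtaleThetaData.DoubleUnderline.IotaStable.of_mem_iff fun z => ?_
    have hz : e.conjX (g * M.inclX y) z = e.conjX g (y * z * y⁻¹) := by
      apply M.injective_inclX
      rw [e.inclX_conjX, e.inclX_conjX]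
      simp only [map_mul, map_inv]
      group
    rw [hz, hι.mem_iff]
    constructor
    · intro h
      have := C.Huu.mul_mem (C.Huu.mul_mem (C.Huu.inv_mem hy) h) hy
      rwa [← mul_assoc, ← mul_assoc, inv_mul_cancel, one_mul, inv_mul_cancel_right] at this
    · intro h
      exact C.Huu.mul_mem (C.Huu.mul_mem hy h) (C.Huu.inv_mem hy)
  have hcH : ∀ h ∈ H, c * h * c⁻¹ ∈ H := fun h hh => e.conj_mem_closureHuu ιC C hι' hh
  -- (2) `Π_C̲ := Π_X̲·⟨c⟩`, the eigenspace, the splitting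
  set H' := Xu ⊔ Subgroup.zpowers c with hH'
  have hTPm : X.toCoverData.IsTypeLTorsPm H' :=
    e.isTypeLTorsPm_ofSetting ιC hιC op hodd hx hIx hιell hN hcΔ hcX
  have hXuH' : Xu = H' ⊓ X.PiX :=
    (sup_zpowers_inf_eq_of_sq_mem hXuX (e.sq_mem_closureXu_of_inv_ell ιC hιC op hodd hιell hcΔ hcX) hcX).symm
  have hιc : X.toCoverData.IsInversion H' c := e.isInversion_ofSetting ιC hιC op hodd hx hIx hιell hcΔ hcX
  have hEc : X.toCoverData.IsMinusEigen Xu H' c (H ⊓ I.augGK.ker) :=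
    e.isMinusEigen_ofHuu ιC hιC op hodd hx hIx hιell hN C hK H' hcΔ hcX fun e' he' =>
      ⟨hcH e' he'.1, (MonoidHom.normal_ker _).conj_mem _ he'.2 c⟩
  have hS := e.isSplitting_ofHuu ιC hιC op hodd hx hIx hιell C hK hA
  have hSE := e.splitting_sup_eigen_eq_closureHuu ιC hιC C hA
  -- (3) the inversion of order `2` (Prop. 2.2 (iii))
  have hex : ∃ ι₀ : PC, X.toCoverData.IsInversion H' ι₀ ∧ ι₀ * ι₀ ∈ I.barKer l := by
    obtain ⟨ι₀, hι₀, h2, -⟩ := (X.prop22_iii_holds Xu H' _ _ c hTPm hXuH' hιc hEc hS).1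
    exact ⟨ι₀, hι₀, h2⟩
  obtain ⟨ι₀, hι₀, h2⟩ := hex
  have hι₀Δ : ι₀ ∈ I.augGK.ker := hι₀.mem_delta
  have hι₀X : ι₀ ∉ I.PiX := hι₀.not_mem
  -- `ι₀ = c·d` with `d ∈ Δ_X̲`; `ι₀` normalises `E`
  have hd : c⁻¹ * ι₀ ∈ Xu ⊓ I.augGK.ker := by
    refine Subgroup.mem_inf.2 ⟨?_, Subgroup.mul_mem _ (Subgroup.inv_mem _ hcΔ) hι₀Δ⟩
    rw [hXuH']
    refine Subgroup.mem_inf.2 ⟨Subgroup.mul_mem _ (Subgroup.inv_mem _ hιc.mem) hι₀.mem, ?_⟩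
    exact (Subgroup.mul_mem_iff_of_index_two I.index_range).2
      (iff_of_false (fun h => hcX (inv_mem_iff.1 h)) hι₀X)
  have hι₀E : ∀ e' ∈ H ⊓ I.augGK.ker, ι₀ * e' * ι₀⁻¹ ∈ H ⊓ I.augGK.ker := by
    intro e' he'
    have h1 := hEc.conj_mem (c⁻¹ * ι₀) hd.1 e' he'
    have h2' : c * (c⁻¹ * ι₀ * e' * (c⁻¹ * ι₀)⁻¹) * c⁻¹ = ι₀ * e' * ι₀⁻¹ := by group
    rw [← h2']
    exact ⟨hcH _ h1.1, (MonoidHom.normal_ker _).conj_mem _ h1.2 c⟩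
  have hE₀ : X.toCoverData.IsMinusEigen Xu H' ι₀ (H ⊓ I.augGK.ker) :=
    e.isMinusEigen_ofHuu ιC hιC op hodd hx hIx hιell hN C hK H' hι₀Δ hι₀X hι₀E
  have hE₀' : X.toCoverData.IsMinusEigen (H' ⊓ X.PiX) H' ι₀ (H ⊓ I.augGK.ker) := by
    rw [show (H' ⊓ X.PiX : Subgroup X.PiC) = Xu from hXuH'.symm]
    exact hE₀
  -- (4) conclusions
  have hnorm : ∀ h ∈ H, ι₀ * h * ι₀⁻¹ ∈ H := fun h hh =>
    hSE.le (X.inversion_conj_mem_sup hTPm hXuH' hι₀ hE₀ hS h2 (hSE.ge hh))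
  have hle : H ⊔ Subgroup.zpowers ι₀ ≤ H' :=
    sup_le (hHXu.trans le_sup_left) ((Subgroup.zpowers_le).2 hι₀.mem)
  have hkey := X.sup_zpowers_inf_eq hTPm hXuH' hι₀ hE₀ hS h2
  refine ⟨ι₀, ⟨⟨H', _, _, ι₀, hTPm, hι₀, h2, hE₀', hS,
    congrArg (fun K : Subgroup PC => K ⊔ Subgroup.zpowers ι₀) hSE.symm⟩⟩, ?_, hι₀Δ, hι₀X, h2, hnorm⟩
  refine le_antisymm ?_ (le_inf le_sup_left (hHXu.trans hXuX))
  rintro z ⟨hz1, hz2⟩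
  have hzXu : z ∈ Xu := by
    rw [hXuH']
    exact Subgroup.mem_inf.2 ⟨hle hz1, hz2⟩
  have hz1' := (sup_le_sup_right hSE.ge (Subgroup.zpowers ι₀)) hz1
  exact hSE.le (hkey.le (Subgroup.mem_inf.2 ⟨hz1', hzXu⟩))

end Binders

end MuTwoSetting.CLevelData

end Literature.AnabelianGeometry.EtaleTheta

end
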